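import Summits.QuantumFields.BalabanUV.T4Continuum.Support.ShellMeasureLinearizedEndFromQ
import Summits.QuantumFields.BalabanUV.T4Continuum.Support.ShellMeasureLinearizedGammaTEnd
import Literature.MathematicalPhysics.QuantumFieldTheory.Balaban1983to89.B12PlaquetteLoop267

/-!
# `T4Continuum.ShellMeasureLinearizedEndGammaT` — (LR)_j: THE COMPOSED END OF RECORD FOR THE PRINTED AVERAGE [B7] (15):
# a live slot charted by print's linearizing substitution for `Q̃_V` asks, on the ANALYTIC side, ONLY print's regime
# hypotheses on the (exterior-indexed) background — `ShellMeasureLinearizedEndFromQ.slotAC_linearizedWindow_of_Q` FIRED at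
# row S52's objects `QtΓ`, `hopΓ`, `κΓ`, `κ𝔸` per exterior point
(cell `pub-balaban`, sub-cell `t4`, spine estimate NE7c (node U5b); NE7c ROUND-2 crew seat
`b2b-balaban-t4-ne7c-formalise-leaf-02` gen 7 — row S60 «W-d INTO END-II» of the owner's table
`t4/b2b-balaban-t4-ne7c-p1/LEAVES-NE7c-P1.md` v2.5 (journal `CLAIMS.log` «CLAIM NE7c-S60»), file 2∕2 after this seat's
`ShellMeasureLinearizedEndFromQ` (p219784); ADDITIVE — imports `ShellMeasureLinearizedEndFromQ`, leaf-08-g10's S52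
`ShellMeasureLinearizedGammaTEnd` (p219653; hence S52 f1, S49 f2, S50 f2, S51) and the Literature leaf `B12PlaquetteLoop267`
only, modifies nothing; [folklore] instantiation BY NAME; 0 `def`, 0 `def … : Prop`, 0 sorry, 0 citations)

HONEST FRAMING.  Finite four-torus programme, rung (B)+1 only — NOT infinite volume, NOT a mass gap, NOT the Clay
problem, NOT summit progress; (B), `BetaPertHyp`, (B^μ) not consumed.  NE7c (`T4IndicatorShell.ShellWeightBound`) is
NOT PRINTED and NOT PROVED; «NE7c ⇐ the named binders» (trigger c3).  What is KERNEL here: for the PRINTED one-step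
average (15) = (2.4) with the contours (1.7) (`B12AverageCorridor267.Qtilde` at `gammaT`; corner cubes on `ℤᵈ`,
DIVERGENCE D-b12g20.1 inherited) the (Q1)–(Q4) + `hop` block of `slotAC_linearizedWindow_of_Q` is DISCHARGED per
exterior point from print's REGIME hypotheses on the background (`0 < L`; UNITARY `V z b` with unit bounds; off-axis
block loops `ε`-regular at every coarse bond, `0 ≤ ε ≤ 1∕8`; Neumann budget `(Lᵈ∕L)·24ε < 1` — `h_paragraph_p267_gammaT`'s
+ unitarity; referee DV-26: «(Q1)–(Q4) KERNEL UNDER THE REGIME BINDER», never «p. 267 linearization proved for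
Bałaban's backgrounds» — for `U_k` the regime is the printed regularity (B11 (19)–(21) ∕ B14 (2.16)–(2.17)) TYPE,
DISPLAYED, W-a family).  What stays DISPLAYED: the [dict] identification of the slot's DENSITY and classifier at
the charted point (node O), SM-L1∕L3∕L4 for Bałaban's OWN terms (W-a∕W-b), SM-L5∕L6 (W-e), numbers∕(SM), the solution
`D̃` as a binder (it EXISTS: S52 `realForm_chartData_gammaT`), the splitting `Ψ` ∕ section `σ` (exist: S52 f1
`exists_splitting_gammaT`, S50 f1).  HONEST DEPENDENCY (cell, verbatim): continuum YM on T⁴ ⇐ BetaPertH ∧ nine spine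
estimates (0/9 proved); BetaPertH ⇐ (D1) ∧ (D4) ∧ CAP+tail; G-an2-4 gates asym, D1 and NE2/3/4.

CONTENT.  §1 per-background bookkeeping (`QtΓ_bound_one`: (Q3) with `M_Q = 1` on the ball `1∕(2816(d+1)L)`, S49 f2;
`fderiv_QtΓ_hopΓ`: S46's `hLQh` from S52 f1 `fderiv_hopΓ` at the Fréchet derivative supplied by S49 f2's
analyticity).  §2 **`slotAC_linearizedWindow_gammaT`** = `slotAC_linearizedWindow_of_Q` with `𝒴 := ↥(qppBonds L c) → 𝔸`,
`𝒳 := 𝔸`, `κ_𝒴 := κΓ` (componentwise ⋆), `κ_𝒳 := κ𝔸` (⋆), `Qt z := QtΓ L (V z) c`, `hop z := hopΓ …`, `R := 1∕(2816(d+1)L)`,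
`M_Q := 1`, `b := (Lᵈ∕L)∕(1 − (Lᵈ∕L)·24ε)`; the binders `hR hQa hQ0 hQM hQt hLQh hb hHop hhop` ALL DISCHARGED (S49 f2
`analyticOnNhd_Qtilde_gammaT` ∕ `norm_Qtilde_gammaT_le`, S52 f1 `QtΓ_zero` ∕ `norm_hopΓ_le` ∕ `fderiv_hopΓ` ∕ `hopΓ_star`,
S52 f2 `QtΓ_conj`, S50 f2 `hGen_star_gammaT_unitary`, S48 `hop_bound_nonneg`); the chart is S52's
`B ↦ B − hΓ (DtΓℝ B)` by its defining equation (`realForm_chart_eq` is `rfl`).  CONCLUSION: S33 f1's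
`SlotAntiConcentration ((μE.prod ζ).withDensity G) u θ ρ (2(finrank ℝ Kf + β Σ_p L̄_p(d̄_p + 4s̄_p) + (B_𝓔 + B_J))∕(1−δ))`
with `B_J = 3·(2·dim_ℂ(↥(qppBonds L c) → 𝔸)·(−log(1 − 18·Mq R 1·b·r)))∕(Rad − 1)`.  §3 **`slotAC_linearizedWindow_gammaT_matrix`**
— the row's typing: `𝔸 := Matrix (Fin N) (Fin N) ℂ` with the L²-operator (C⋆) norm, every class by instance resolution,
Borel structures by hypothesis (as S52 §3), and the regime stated as PRINT'S PLAQUETTE REGULARITY of a unitary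
background (`‖V z (∂p) − 1‖ ≤ ε₀`, `24·d·L^{d+1}·ε₀ < 1`; loop regime `ε := ω(ε₀)` by `B12PlaquetteLoop267`, the owner's
f5 route).  THE [dict] RESIDUAL OF W-d, SAID: the typing junction between the chart variable `↥(qppBonds L c) → M_N(ℂ)`
(Hermitian window `Fix(κΓ)`) and END-II's block chart of the slot is NOT proved here — it is EXACTLY the displayed
dictionary `hFdict`∕`hudict`∕`hGsupp` (the slot's DENSITY `G` and tested variable `u` READ at the charted point), node O.
NOT an instance of SM-L1…L6 for Bałaban's measures; NOTHING in the countdown moves; NE7c NOT PROVED; spine PROVED 0/9.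
-/

noncomputable section

open Set Function MeasureTheory MeasureTheory.Measure Metric Filter Topology

namespace Summit.QuantumFields.BalabanUV.T4Continuum.ShellMeasureLinearizedEndGammaT

open scoped ENNReal NNReal
open Literature.MathematicalPhysics.QuantumFieldTheory.Balaban1983to89
open Literature.MathematicalPhysics.QuantumLattice (ZdEdge plaquetteHolonomyZd)
open B8Lemma1NonAbelian (omegaC omegaC_nonneg)
open B12PlaquetteLoop267 (norm_loopW_sub_one_le thresholds_of_small)
open B7BlockGeometry (qppBonds)
open B12HOperator267 (gammaT)
open B12AverageCorridor267 (loopW offAxis isAxisStraightFamily_gammaT hGen)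
open T4ShellMeasure (SlotAntiConcentration)
open ShellMeasureWilsonTrace (TraceData)
open ShellMeasureWilsonMoving (MLetter mwordEval mdFro sSum lSum)
open ShellMeasureLevelAssembly (classifier weight)
open Summit.QuantumFields.BalabanUV.Beta.LinearizingChange267FromQ (nonlin Mq)
open ShellMeasureLinearizedRealStructure (realSub incl reP)
open ShellMeasureAverageDerivative (hop_bound_nonneg)
open ShellMeasureAverageAnalyticB7 (analyticOnNhd_Qtilde_gammaT norm_Qtilde_gammaT_le)
open ShellMeasureAverageHStructure (hGen_star_gammaT_unitary)
open ShellMeasureLinearizedGammaT (QtΓ QtΓ_zero hopΓ norm_hopΓ_le fderiv_hopΓ κ𝔸 κΓ κ𝔸_invol κΓ_invol hopΓ_star TΓ hΓ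
  DtΓℝ QtΓ_conj)
open ShellMeasureLinearizedEndFromQ (slotAC_linearizedWindow_of_Q)

variable {d : ℕ} {𝔸 : Type*} [NormedRing 𝔸] [NormedAlgebra ℂ 𝔸] [CompleteSpace 𝔸] [NormOneClass 𝔸]
  [StarRing 𝔸] [CStarRing 𝔸] [StarModule ℂ 𝔸] {L : ℕ} {c : ZdEdge d}

/-! ## §1 Per-background bookkeeping -/

omit [StarRing 𝔸] [CStarRing 𝔸] [StarModule ℂ 𝔸] in
/-- (Q3) WITH `M_Q = 1`: on the ball of radius `1∕(2816(d+1)L)` the printed chart average has norm `≤ 1` (S49 f2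
`norm_Qtilde_gammaT_le`: `≤ 2816(d+1)L·‖B‖`). [folklore] -/
theorem QtΓ_bound_one (hL : 0 < L) {V : ZdEdge d → 𝔸ˣ}
    (hV : ∀ b, ‖((V b : 𝔸ˣ) : 𝔸)‖ ≤ 1) (hV' : ∀ b, ‖(((V b)⁻¹ : 𝔸ˣ) : 𝔸)‖ ≤ 1) {ε : ℝ} (hε0 : 0 ≤ ε) (hε : ε ≤ 1 / 8)
    (hWc : ∀ x ∈ offAxis L c, ‖((loopW L (fun U : ZdEdge d → 𝔸ˣ => gammaT L U) V c x : 𝔸ˣ) : 𝔸) - 1‖ ≤ ε) :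
    ∀ B ∈ ball (0 : ↥(qppBonds L c) → 𝔸) (1 / (2816 * ((d : ℝ) + 1) * L)), ‖QtΓ L V c B‖ ≤ 1 := by
  intro B hB
  rw [mem_ball_zero_iff] at hB
  have hLr : (0 : ℝ) < L := by exact_mod_cast hL
  have hK : (0 : ℝ) < 2816 * ((d : ℝ) + 1) * L := by positivity
  refine (norm_Qtilde_gammaT_le hL hV hV' hε0 hε hWc hB).trans ?_
  calc 2816 * ((d : ℝ) + 1) * L * ‖B‖ ≤ 2816 * ((d : ℝ) + 1) * L * (1 / (2816 * ((d : ℝ) + 1) * L)) :=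
        mul_le_mul_of_nonneg_left hB.le hK.le
    _ = 1 := mul_one_div_cancel hK.ne'

omit [StarRing 𝔸] [CStarRing 𝔸] [StarModule ℂ 𝔸] in
/-- S46's `hLQh` FOR (15): `DQ̃_V(0) (hopΓ X) = X` — S52 f1 `fderiv_hopΓ` at the Fréchet derivative of the analytic
chart average (S49 f2). [folklore] -/
theorem fderiv_QtΓ_hopΓ (hL : 0 < L) {V : ZdEdge d → 𝔸ˣ} {ε : ℝ} (hε0 : 0 ≤ ε) (hε : ε ≤ 1 / 8)
    (hW : ∀ c', ∀ x ∈ offAxis L c', ‖((loopW L (fun U : ZdEdge d → 𝔸ˣ => gammaT L U) V c' x : 𝔸ˣ) : 𝔸) - 1‖ ≤ ε)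
    (hV : ∀ b, ‖((V b : 𝔸ˣ) : 𝔸)‖ ≤ 1) (hV' : ∀ b, ‖(((V b)⁻¹ : 𝔸ˣ) : 𝔸)‖ ≤ 1)
    (hbud : (L : ℝ) ^ d / L * (24 * ε) < 1) (X : 𝔸) :
    fderiv ℂ (QtΓ L V c) 0 (hopΓ hL V hε0 hε hW hV hV' hbud c X) = X := by
  have hLr : (0 : ℝ) < L := by exact_mod_cast hL
  have hR : (0 : ℝ) < 1 / (2816 * ((d : ℝ) + 1) * L) := by positivity
  exact fderiv_hopΓ hL V hε0 hε hW hV hV' hbud c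
    ((analyticOnNhd_Qtilde_gammaT hL hV hV' hε0 hε (hW c) 0 (mem_ball_self hR)).differentiableAt.hasFDerivAt) X

/-! ## §2 The composed END of record for the printed average -/

variable [FiniteDimensional ℂ 𝔸] [MeasurableSpace 𝔸] [BorelSpace 𝔸] [MeasurableSpace (↥(qppBonds L c) → 𝔸)]
  [BorelSpace (↥(qppBonds L c) → 𝔸)]

/-- **THE (LR)_j END OF RECORD FOR [B7] (15) — ANALYTIC SIDE FROM PRINT'S REGIME HYPOTHESES ALONE.**
`ShellMeasureLinearizedEndFromQ.slotAC_linearizedWindow_of_Q` with, per exterior point `z`, the printed chart average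
`QtΓ L (V z) c` of the background `V z`, p. 267's `hopΓ`, the ⋆-conjugations `κΓ`∕`κ𝔸`, `R := 1∕(2816(d+1)L)`, `M_Q := 1`,
`b := (Lᵈ∕L)∕(1 − (Lᵈ∕L)·24ε)`: the binders (Q1)–(Q4), `hLQh`, `hb`, `hHop`, `hhop` are THEOREMS (S49 f2, S52, S50 f2,
S48).  REMAINING HYPOTHESES: print's regime on every `V z` (unitary, unit bounds, `ε`-regular off-axis loops at all
coarse bonds, `0 ≤ ε ≤ 1∕8`, `(Lᵈ∕L)·24ε < 1`) with `ε` UNIFORM in `z`; the window radius `εw` (`9·Mq R 1·b·εw ≤ 1∕2`,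
`3εw ≤ R`); a solution `Dt z` of print's fixed-point equation on `‖B‖ < εw`; a splitting `Ψ z` along the real
`DQ̃(0)` (`TΓ`) with a measurable section `σ z`; the chart `Φ z := B ↦ B − hΓ (DtΓℝ (Dt z) εw B)` by its defining
equation; and — DISPLAYED, untouched — the block density `G` supported in the chart image with `hfin`, the level data,
the DICTIONARY OF THE DENSITY ALONE `hFdict`∕`hudict`, window placement `hWr`, SM-L5∕L6, SM-L1, SM-L3, SM-L4 for the
OTHER terms, numbers + (SM).  CONCLUSION: S33 f1's with `B_𝓔 + B_J`.  [folklore] -/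
theorem slotAC_linearizedWindow_gammaT (hL : 0 < L) (μE : Measure (realSub (κΓ 𝔸 L c))) [μE.IsAddHaarMeasure]
    {Kf : Type*} [NormedAddCommGroup Kf] [NormedSpace ℝ Kf] [MeasurableSpace Kf] [BorelSpace Kf]
    [FiniteDimensional ℝ Kf] (μK : Measure Kf) [μK.IsAddHaarMeasure]
    {A : Type*} [NormedRing A] [NormedAlgebra ℂ A] [CompleteSpace A] [NormOneClass A]
    {Z : Type*} [MeasurableSpace Z] (ζ : Measure Z) [SFinite ζ]
    -- PRINT'S REGIME on the exterior-indexed background, `ε` uniform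
    {V : Z → ZdEdge d → 𝔸ˣ} (hVu : ∀ z b, (V z b : 𝔸) ∈ unitary 𝔸)
    (hV : ∀ z b, ‖((V z b : 𝔸ˣ) : 𝔸)‖ ≤ 1) (hV' : ∀ z b, ‖(((V z b)⁻¹ : 𝔸ˣ) : 𝔸)‖ ≤ 1) {ε : ℝ} (hε0 : 0 ≤ ε)
    (hε : ε ≤ 1 / 8)
    (hW : ∀ z c', ∀ x ∈ offAxis L c', ‖((loopW L (fun U : ZdEdge d → 𝔸ˣ => gammaT L U) (V z) c' x : 𝔸ˣ) : 𝔸) - 1‖ ≤ ε)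
    (hbud : (L : ℝ) ^ d / L * (24 * ε) < 1)
    -- the window radius
    {εw : ℝ} (hq2 : 9 * Mq (1 / (2816 * ((d : ℝ) + 1) * L)) 1 *
      (((L : ℝ) ^ d / L) / (1 - (L : ℝ) ^ d / L * (24 * ε))) * εw ≤ 1 / 2)
    (hRC : 3 * εw ≤ 1 / (2816 * ((d : ℝ) + 1) * L))
    -- a solution of print's fixed-point equation per exterior point
    {Dt : Z → (↥(qppBonds L c) → 𝔸) → 𝔸}
    (hDball : ∀ z, ∀ B : ↥(qppBonds L c) → 𝔸, ‖B‖ < εw →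
      Dt z B ∈ closedBall (0 : 𝔸) (4 * Mq (1 / (2816 * ((d : ℝ) + 1) * L)) 1 * εw ^ 2))
    (hDfix : ∀ z, ∀ B : ↥(qppBonds L c) → 𝔸, ‖B‖ < εw →
      nonlin (QtΓ L (V z) c) (B - hopΓ hL (V z) hε0 hε (hW z) (hV z) (hV' z) hbud c (Dt z B)) = Dt z B)
    -- the splitting along the real `DQ̃(0)` and its section
    (Ψ : Z → (Kf × realSub (κ𝔸 𝔸)) ≃L[ℝ] realSub (κΓ 𝔸 L c)) (hΨ : ∀ z y, ((Ψ z).symm y).2 = TΓ L (V z) c y)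
    {σ : Z → realSub (κ𝔸 𝔸) → realSub (κΓ 𝔸 L c)} (hσm : ∀ z, Measurable (σ z))
    (hσ : ∀ z a, ((Ψ z).symm (σ z a)).2 = a)
    -- the chart by its defining equation
    {Φ : Z → realSub (κΓ 𝔸 L c) → realSub (κΓ 𝔸 L c)}
    (hΦ : ∀ z, Φ z = fun B => B - hΓ hL (V z) hε0 hε (hW z) (hV z) (hV' z) hbud c (DtΓℝ L c (Dt z) εw B))
    -- the realized slot law
    {G : realSub (κΓ 𝔸 L c) × Z → ℝ≥0∞} (hG : Measurable G) {u : realSub (κΓ 𝔸 L c) × Z → ℝ} (hu : Measurable u)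
    (hGsupp : ∀ z y, G (y, z) ≠ 0 → y ∈ Φ z '' {y : realSub (κΓ 𝔸 L c) | ‖incl (κΓ 𝔸 L c) y‖ < εw})
    (hfin : ∀ z a, (μK.withDensity fun x => ({y : realSub (κΓ 𝔸 L c) | ‖incl (κΓ 𝔸 L c) y‖ < εw}).indicator
      (fun y => G (Φ z y, z)) (σ z a + Ψ z (x, 0))) univ ≠ ∞)
    -- level data per exterior point AND average value, in the fibre coordinate
    (Ttr : TraceData A) (hN : 0 < Ttr.N) {ι κ : Type*} {Pu : Finset ι} (hPu : Pu.Nonempty)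
    (hol : Z → realSub (κ𝔸 𝔸) → ι → Kf → A) (hcont : ∀ z a, ∀ p ∈ Pu, Continuous (hol z a p))
    (Pw : Finset κ) (Gw : Z → realSub (κ𝔸 𝔸) → κ → Kf → A) (𝓔 : Z → realSub (κ𝔸 𝔸) → Kf → ℝ)
    (W : Z → realSub (κ𝔸 𝔸) → Set Kf) (Jco : Z → realSub (κ𝔸 𝔸) → Kf → ℝ≥0∞) {θ δ ρ β Rad H B𝓔 r : ℝ}
    {sw lw dw : κ → ℝ}
    -- DICTIONARY at the charted point — the DENSITY ALONE
    (hFdict : ∀ z a x, ({y : realSub (κΓ 𝔸 L c) | ‖incl (κΓ 𝔸 L c) y‖ < εw}).indicator (fun y => G (Φ z y, z))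
      (σ z a + Ψ z (x, 0)) = Jco z a x * weight Ttr β Pw (Gw z a) (𝓔 z a) x)
    (hudict : ∀ z a x, ({y : realSub (κΓ 𝔸 L c) | ‖incl (κΓ 𝔸 L c) y‖ < εw}).indicator (fun y => G (Φ z y, z))
      (σ z a + Ψ z (x, 0)) ≠ 0 → u (Φ z (σ z a + Ψ z (x, 0)), z) = classifier hPu (hol z a) x)
    -- window placement
    (hWr : ∀ z a, ∀ x ∈ W z a, ‖σ z a‖ + Rad * ‖Ψ z (x, 0)‖ ≤ r) (hr0 : 0 ≤ r) (hrε : r < εw)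
    -- SM-L5/L6
    (hJW : ∀ z a x, Jco z a x ≠ 0 → x ∈ W z a)
    (hJ : ∀ z a x, ∀ a' : ℝ, 0 ≤ a' → Jco z a x ≤ Jco z a (Real.exp (-a') • x))
    -- SM-L1
    (hRad : 1 < Rad)
    (hAN : ∀ z a, ∀ x ∈ W z a, ∀ p ∈ Pu, ∃ f : ℂ → A, DifferentiableOn ℂ f (ball 0 Rad) ∧
      (∀ w ∈ ball (0 : ℂ) Rad, ‖f w‖ ≤ H) ∧ f 0 = 0 ∧
      ∀ c' : ℝ, 0 ≤ c' → c' ≤ 1 → f (c' : ℂ) = hol z a p (c' • x) - 1)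
    -- SM-L3
    (hGW : ∀ z a, ∀ x ∈ W z a, ∀ p ∈ Pw, ∃ gw : List (MLetter A × ℝ × ℝ), (∀ y ∈ gw, y.1.Good Ttr.τ y.2.1 y.2.2) ∧
      sSum gw ≤ sw p ∧ lSum gw ≤ lw p ∧ mdFro (gw.map Prod.fst) ≤ dw p ∧
      ∀ c' : ℝ, 0 ≤ c' → c' ≤ 1 → mwordEval c' (gw.map Prod.fst) = Gw z a p (c' • x))
    (hsw1 : ∀ p ∈ Pw, sw p ≤ 1) (hsw0 : ∀ p ∈ Pw, 0 ≤ sw p) (hlw0 : ∀ p ∈ Pw, 0 ≤ lw p)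
    (hdw0 : ∀ p ∈ Pw, 0 ≤ dw p)
    -- SM-L4 for the OTHER terms
    (hE : ∀ z a, ∀ x ∈ W z a, ∀ c' : ℝ, 1 / 2 ≤ c' → c' ≤ 1 → 𝓔 z a (c' • x) ≤ 𝓔 z a x + (1 - c') * B𝓔)
    (hB𝓔 : 0 ≤ B𝓔)
    -- numbers + (SM)
    (hθ : 0 < θ) (hδ0 : 0 ≤ δ) (hδ1 : δ < 1) (hρ0 : 0 ≤ ρ) (hρ : ρ ≤ (1 - δ) / 2) (hβ : 0 ≤ β)
    (hSM : 36 * H * 1 ^ 2 / (Rad - 1) ^ 2 ≤ δ * θ) :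
    SlotAntiConcentration ((μE.prod ζ).withDensity G) u θ ρ
      (2 * ((Module.finrank ℝ Kf : ℝ) + (β * ∑ p ∈ Pw, lw p * (dw p + 4 * sw p) +
        (B𝓔 + 3 * (2 * (Module.finrank ℂ (↥(qppBonds L c) → 𝔸) *
          (-Real.log (1 - 18 * Mq (1 / (2816 * ((d : ℝ) + 1) * L)) 1 *
            (((L : ℝ) ^ d / L) / (1 - (L : ℝ) ^ d / L * (24 * ε))) * r)))) / (Rad - 1)))) / (1 - δ)) := by
  have hLr : (0 : ℝ) < L := by exact_mod_cast hL
  have hR : (0 : ℝ) < 1 / (2816 * ((d : ℝ) + 1) * L) := by positivity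
  exact slotAC_linearizedWindow_of_Q (κX := κ𝔸 𝔸) (κY := κΓ 𝔸 L c) μE μK κ𝔸_invol κΓ_invol ζ
    (Qt := fun z => QtΓ L (V z) c) (hop := fun z => hopΓ hL (V z) hε0 hε (hW z) (hV z) (hV' z) hbud c) hR
    (fun z => analyticOnNhd_Qtilde_gammaT hL (hV z) (hV' z) hε0 hε (hW z c)) (fun z => QtΓ_zero L (V z) c)
    (fun z => QtΓ_bound_one hL (hV z) (hV' z) hε0 hε (hW z c))
    (fun z => QtΓ_conj hL (hVu z) (hV z) (hV' z) hε0 hε (hW z c))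
    (fun z X => fderiv_QtΓ_hopΓ hL hε0 hε (hW z) (hV z) (hV' z) hbud X) (hop_bound_nonneg hL hbud)
    (fun z X => norm_hopΓ_le hL (V z) hε0 hε (hW z) (hV z) (hV' z) hbud c X)
    (fun z X => hopΓ_star hL (V z) hε0 hε (hW z) (hV z) (hV' z) hbud c
      (hGen_star_gammaT_unitary hL (V z) hε0 hε (hW z) (hV z) (hV' z) hbud (hVu z) c) X)
    hq2 hRC hDball hDfix Ψ hΨ hσm hσ hΦ hG hu hGsupp hfin Ttr hN hPu hol hcont Pw Gw 𝓔 W Jco hFdict hudict hWr hr0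
    hrε hJW hJ hRad hAN hGW hsw1 hsw0 hlw0 hdw0 hE hB𝓔 hθ hδ0 hδ1 hρ0 hρ hβ hSM

/-! ## §3 The row's typing: `𝔸 := M_N(ℂ)` (L²-operator norm), UNITARY PLAQUETTE-REGULAR backgrounds -/

section MatrixTyping

open scoped Matrix.Norms.L2Operator

/-- **NE7c-S60 AT THE MATRIX TYPING, REGIME = PRINT'S PLAQUETTE REGULARITY.**  `slotAC_linearizedWindow_gammaT` for
`𝔸 := Matrix (Fin N) (Fin N) ℂ` (`N ≠ 0`, L²-operator = C⋆ norm; every class by instance resolution, Borel structures by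
hypothesis as in S52 §3) and the exterior-indexed background UNITARY and PLAQUETTE-REGULAR: `‖V z (∂p) − 1‖ ≤ ε₀` for
every plaquette ([B12] p. 254 ∕ B11 (19)–(21) TYPE, the `h44` shape), `1 ≤ d`, `24·d·L^{d+1}·ε₀ < 1` — the loop regime
`ε := ω(ε₀)` (`B8Lemma1NonAbelian.omegaC`), its thresholds and the Neumann budget being `B12PlaquetteLoop267`'s
`norm_loopW_sub_one_le` ∕ `thresholds_of_small` (the owner's f5 route).  Window, `D̃`, splitting, chart-by-equation,
density-side binders and conclusion as in §2 with `b := (Lᵈ∕L)∕(1 − (Lᵈ∕L)·24ω(ε₀))`. [folklore] -/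
theorem slotAC_linearizedWindow_gammaT_matrix {N : ℕ} [NeZero N]
    [MeasurableSpace (Matrix (Fin N) (Fin N) ℂ)] [BorelSpace (Matrix (Fin N) (Fin N) ℂ)]
    [MeasurableSpace (↥(qppBonds L c) → Matrix (Fin N) (Fin N) ℂ)] [BorelSpace (↥(qppBonds L c) → Matrix (Fin N) (Fin N) ℂ)]
    (hL : 0 < L) (hd : 1 ≤ d) (μE : Measure (realSub (κΓ (Matrix (Fin N) (Fin N) ℂ) L c))) [μE.IsAddHaarMeasure]
    {Kf : Type*} [NormedAddCommGroup Kf] [NormedSpace ℝ Kf] [MeasurableSpace Kf] [BorelSpace Kf]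
    [FiniteDimensional ℝ Kf] (μK : Measure Kf) [μK.IsAddHaarMeasure]
    {A : Type*} [NormedRing A] [NormedAlgebra ℂ A] [CompleteSpace A] [NormOneClass A]
    {Z : Type*} [MeasurableSpace Z] (ζ : Measure Z) [SFinite ζ]
    -- PRINT'S REGULARITY of the exterior-indexed unitary background, `ε₀` uniform
    {V : Z → ZdEdge d → (Matrix (Fin N) (Fin N) ℂ)ˣ}
    (hVu : ∀ z b, (V z b : Matrix (Fin N) (Fin N) ℂ) ∈ unitary (Matrix (Fin N) (Fin N) ℂ))
    (hV : ∀ z b, ‖((V z b : (Matrix (Fin N) (Fin N) ℂ)ˣ) : Matrix (Fin N) (Fin N) ℂ)‖ ≤ 1)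
    (hV' : ∀ z b, ‖(((V z b)⁻¹ : (Matrix (Fin N) (Fin N) ℂ)ˣ) : Matrix (Fin N) (Fin N) ℂ)‖ ≤ 1)
    {ε₀ : ℝ} (hε₀ : 0 ≤ ε₀) (hsmall : 24 * (d : ℝ) * (L : ℝ) ^ (d + 1) * ε₀ < 1)
    (h44 : ∀ z (p : Fin d → ℤ) (i j : Fin d), i ≠ j →
      ‖((plaquetteHolonomyZd (V z) p i j : (Matrix (Fin N) (Fin N) ℂ)ˣ) : Matrix (Fin N) (Fin N) ℂ) - 1‖ ≤ ε₀)
    -- the window radius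
    {εw : ℝ} (hq2 : 9 * Mq (1 / (2816 * ((d : ℝ) + 1) * L)) 1 *
      (((L : ℝ) ^ d / L) / (1 - (L : ℝ) ^ d / L * (24 * omegaC d L ε₀))) * εw ≤ 1 / 2)
    (hRC : 3 * εw ≤ 1 / (2816 * ((d : ℝ) + 1) * L))
    -- a solution of print's fixed-point equation per exterior point
    {Dt : Z → (↥(qppBonds L c) → Matrix (Fin N) (Fin N) ℂ) → Matrix (Fin N) (Fin N) ℂ}
    (hDball : ∀ z, ∀ B : ↥(qppBonds L c) → Matrix (Fin N) (Fin N) ℂ, ‖B‖ < εw →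
      Dt z B ∈ closedBall (0 : Matrix (Fin N) (Fin N) ℂ) (4 * Mq (1 / (2816 * ((d : ℝ) + 1) * L)) 1 * εw ^ 2))
    (hDfix : ∀ z, ∀ B : ↥(qppBonds L c) → Matrix (Fin N) (Fin N) ℂ, ‖B‖ < εw →
      nonlin (QtΓ L (V z) c) (B - hopΓ hL (V z) (omegaC_nonneg hL hd hε₀) (thresholds_of_small hL hd hε₀ hsmall).1
        (norm_loopW_sub_one_le hL (V z) (hV z) (hV' z) hε₀ (h44 z)) (hV z) (hV' z)
        (thresholds_of_small hL hd hε₀ hsmall).2 c (Dt z B)) = Dt z B)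
    -- the splitting along the real `DQ̃(0)` and its section
    (Ψ : Z → (Kf × realSub (κ𝔸 (Matrix (Fin N) (Fin N) ℂ))) ≃L[ℝ] realSub (κΓ (Matrix (Fin N) (Fin N) ℂ) L c))
    (hΨ : ∀ z y, ((Ψ z).symm y).2 = TΓ L (V z) c y)
    {σ : Z → realSub (κ𝔸 (Matrix (Fin N) (Fin N) ℂ)) → realSub (κΓ (Matrix (Fin N) (Fin N) ℂ) L c)}
    (hσm : ∀ z, Measurable (σ z)) (hσ : ∀ z a, ((Ψ z).symm (σ z a)).2 = a)
    -- the chart by its defining equation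
    {Φ : Z → realSub (κΓ (Matrix (Fin N) (Fin N) ℂ) L c) → realSub (κΓ (Matrix (Fin N) (Fin N) ℂ) L c)}
    (hΦ : ∀ z, Φ z = fun B => B - hΓ hL (V z) (omegaC_nonneg hL hd hε₀) (thresholds_of_small hL hd hε₀ hsmall).1
        (norm_loopW_sub_one_le hL (V z) (hV z) (hV' z) hε₀ (h44 z)) (hV z) (hV' z)
        (thresholds_of_small hL hd hε₀ hsmall).2 c (DtΓℝ L c (Dt z) εw B))
    -- the realized slot law
    {G : realSub (κΓ (Matrix (Fin N) (Fin N) ℂ) L c) × Z → ℝ≥0∞} (hG : Measurable G)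
    {u : realSub (κΓ (Matrix (Fin N) (Fin N) ℂ) L c) × Z → ℝ} (hu : Measurable u)
    (hGsupp : ∀ z y, G (y, z) ≠ 0 →
      y ∈ Φ z '' {y : realSub (κΓ (Matrix (Fin N) (Fin N) ℂ) L c) | ‖incl (κΓ (Matrix (Fin N) (Fin N) ℂ) L c) y‖ < εw})
    (hfin : ∀ z a, (μK.withDensity fun x =>
      ({y : realSub (κΓ (Matrix (Fin N) (Fin N) ℂ) L c) | ‖incl (κΓ (Matrix (Fin N) (Fin N) ℂ) L c) y‖ < εw}).indicator
        (fun y => G (Φ z y, z)) (σ z a + Ψ z (x, 0))) univ ≠ ∞)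
    -- level data per exterior point AND average value, in the fibre coordinate
    (Ttr : TraceData A) (hN : 0 < Ttr.N) {ι κ : Type*} {Pu : Finset ι} (hPu : Pu.Nonempty)
    (hol : Z → realSub (κ𝔸 (Matrix (Fin N) (Fin N) ℂ)) → ι → Kf → A) (hcont : ∀ z a, ∀ p ∈ Pu, Continuous (hol z a p))
    (Pw : Finset κ) (Gw : Z → realSub (κ𝔸 (Matrix (Fin N) (Fin N) ℂ)) → κ → Kf → A)
    (𝓔 : Z → realSub (κ𝔸 (Matrix (Fin N) (Fin N) ℂ)) → Kf → ℝ) (W : Z → realSub (κ𝔸 (Matrix (Fin N) (Fin N) ℂ)) → Set Kf)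
    (Jco : Z → realSub (κ𝔸 (Matrix (Fin N) (Fin N) ℂ)) → Kf → ℝ≥0∞) {θ δ ρ β Rad H B𝓔 r : ℝ} {sw lw dw : κ → ℝ}
    -- DICTIONARY at the charted point — the DENSITY ALONE (the [dict] residual of W-d, node O)
    (hFdict : ∀ z a x,
      ({y : realSub (κΓ (Matrix (Fin N) (Fin N) ℂ) L c) | ‖incl (κΓ (Matrix (Fin N) (Fin N) ℂ) L c) y‖ < εw}).indicator
        (fun y => G (Φ z y, z)) (σ z a + Ψ z (x, 0)) = Jco z a x * weight Ttr β Pw (Gw z a) (𝓔 z a) x)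
    (hudict : ∀ z a x,
      ({y : realSub (κΓ (Matrix (Fin N) (Fin N) ℂ) L c) | ‖incl (κΓ (Matrix (Fin N) (Fin N) ℂ) L c) y‖ < εw}).indicator
        (fun y => G (Φ z y, z)) (σ z a + Ψ z (x, 0)) ≠ 0 →
      u (Φ z (σ z a + Ψ z (x, 0)), z) = classifier hPu (hol z a) x)
    -- window placement
    (hWr : ∀ z a, ∀ x ∈ W z a, ‖σ z a‖ + Rad * ‖Ψ z (x, 0)‖ ≤ r) (hr0 : 0 ≤ r) (hrε : r < εw)
    -- SM-L5/L6
    (hJW : ∀ z a x, Jco z a x ≠ 0 → x ∈ W z a)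
    (hJ : ∀ z a x, ∀ a' : ℝ, 0 ≤ a' → Jco z a x ≤ Jco z a (Real.exp (-a') • x))
    -- SM-L1
    (hRad : 1 < Rad)
    (hAN : ∀ z a, ∀ x ∈ W z a, ∀ p ∈ Pu, ∃ f : ℂ → A, DifferentiableOn ℂ f (ball 0 Rad) ∧
      (∀ w ∈ ball (0 : ℂ) Rad, ‖f w‖ ≤ H) ∧ f 0 = 0 ∧
      ∀ c' : ℝ, 0 ≤ c' → c' ≤ 1 → f (c' : ℂ) = hol z a p (c' • x) - 1)
    -- SM-L3
    (hGW : ∀ z a, ∀ x ∈ W z a, ∀ p ∈ Pw, ∃ gw : List (MLetter A × ℝ × ℝ), (∀ y ∈ gw, y.1.Good Ttr.τ y.2.1 y.2.2) ∧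
      sSum gw ≤ sw p ∧ lSum gw ≤ lw p ∧ mdFro (gw.map Prod.fst) ≤ dw p ∧
      ∀ c' : ℝ, 0 ≤ c' → c' ≤ 1 → mwordEval c' (gw.map Prod.fst) = Gw z a p (c' • x))
    (hsw1 : ∀ p ∈ Pw, sw p ≤ 1) (hsw0 : ∀ p ∈ Pw, 0 ≤ sw p) (hlw0 : ∀ p ∈ Pw, 0 ≤ lw p)
    (hdw0 : ∀ p ∈ Pw, 0 ≤ dw p)
    -- SM-L4 for the OTHER terms
    (hE : ∀ z a, ∀ x ∈ W z a, ∀ c' : ℝ, 1 / 2 ≤ c' → c' ≤ 1 → 𝓔 z a (c' • x) ≤ 𝓔 z a x + (1 - c') * B𝓔)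
    (hB𝓔 : 0 ≤ B𝓔)
    -- numbers + (SM)
    (hθ : 0 < θ) (hδ0 : 0 ≤ δ) (hδ1 : δ < 1) (hρ0 : 0 ≤ ρ) (hρ : ρ ≤ (1 - δ) / 2) (hβ : 0 ≤ β)
    (hSM : 36 * H * 1 ^ 2 / (Rad - 1) ^ 2 ≤ δ * θ) :
    SlotAntiConcentration ((μE.prod ζ).withDensity G) u θ ρ
      (2 * ((Module.finrank ℝ Kf : ℝ) + (β * ∑ p ∈ Pw, lw p * (dw p + 4 * sw p) +
        (B𝓔 + 3 * (2 * (Module.finrank ℂ (↥(qppBonds L c) → Matrix (Fin N) (Fin N) ℂ) *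
          (-Real.log (1 - 18 * Mq (1 / (2816 * ((d : ℝ) + 1) * L)) 1 *
            (((L : ℝ) ^ d / L) / (1 - (L : ℝ) ^ d / L * (24 * omegaC d L ε₀))) * r)))) / (Rad - 1)))) / (1 - δ)) :=
  slotAC_linearizedWindow_gammaT hL μE μK ζ hVu hV hV' (omegaC_nonneg hL hd hε₀) (thresholds_of_small hL hd hε₀ hsmall).1
    (fun z => norm_loopW_sub_one_le hL (V z) (hV z) (hV' z) hε₀ (h44 z)) (thresholds_of_small hL hd hε₀ hsmall).2 hq2 hRC
    hDball hDfix Ψ hΨ hσm hσ hΦ hG hu hGsupp hfin Ttr hN hPu hol hcont Pw Gw 𝓔 W Jco hFdict hudict hWr hr0 hrε hJW hJ hRad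
    hAN hGW hsw1 hsw0 hlw0 hdw0 hE hB𝓔 hθ hδ0 hδ1 hρ0 hρ hβ hSM

end MatrixTyping

end Summit.QuantumFields.BalabanUV.T4Continuum.ShellMeasureLinearizedEndGammaT

end
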